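import Literature.NumberTheory.NumberFields.KummerPlusMinusRankRadical
import Literature.NumberTheory.NumberFields.KummerEigenvector
import HarnessLib

/-!
# Kummer radicals of eigencharacters under an automorphism of the base: the twisted minus part
# (Lang, *Cyclotomic Fields I and II*, Ch. 13 §2, proof of Thm. 2.1; Washington, *Cyclotomic Fields*, §10.2, proof of Thm. 10.9)

Topic `NumberTheory/NumberFields`; namespaces `Literature.NumberTheory.NumberFields.KummerRank` /
`….KummerEigenvector` (the files being generalised).  Theorem-only file (no definition, no named fact, no
`sorry`), unconditional.  Written by the prover seat `bsd-potss-rkm` g41 (cell `bsd-potss`, `--supports`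
stmt-BirchSwinnertonDyer-19196) as step (R1) of the ISOTYPIC (component-wise) form of Leopoldt's reflection
theorem, whose `±` form is the tree's `KummerPlusMinusRank*.lean` (Lang's Thm. 2.1).

In the `±` proof (`KummerPlusMinusRankRadical.lean`) the radical `β = α^p` of an eigenvector `α` of a character
of `Gal(M/K)`, `M = K E₁` the lift of an unramified abelian `p`-extension of `K⁺`, lies in the MINUS part because
`α · g(α) ∈ K` for a lift `g` of complex conjugation (`IsCMField.mul_conjLift_mem_range_of_isMulCommutative`,
from the commutativity of `Gal(M/K⁺)`).  In the isotypic setting `M` is any Galois extension of `K` stable under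
an automorphism `e` of `M` restricting to an automorphism `σ` of `K`, and the conjugation `τ ↦ e⁻¹ τ e` acts on
the character `χ` of the eigenvector; the same fixed-point computation gives the TWISTED relation
`e(α) = x · α^m` (`x ∈ K`) whenever `σ(χ(e⁻¹τe)) = χ(τ)^m` for all `τ` (Washington's
"`σ` acts on `Gal` by conjugation and on `μ_p` via `ω`", proof of Thm. 10.9).  For `e` a lift of complex
conjugation and an EVEN eigencharacter this is `m ≡ −1`, i.e. `α · e(α) ∈ K` — which is all the radical lemma
needs.  We therefore record:

* `KummerRank.exists_ideal_of_radical_of_mul_mem_range` — §C–§E of `KummerPlusMinusClassNumber.lean` /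
  `KummerRank.exists_ideal_of_radical` with the minus-part input «`α · g(α) ∈ K`» as a HYPOTHESIS (and `g` any
  ring automorphism of `M` restricting to complex conjugation on `K`): `(β) = 𝔟^p`, `𝔟 𝔟̄ = (c')`,
  `c'^p = β β̄`, `N_{K/K⁺}[𝔟] = 1`, `[𝔟]^p = 1`.
* `KummerEigenvector.exists_conj` — the conjugate `e⁻¹ τ e ∈ Gal(M/K)` of `τ ∈ Gal(M/K)` by a ring automorphism
  `e` of `M` restricting to an automorphism of `K` (pointwise form, as `hilbertClassField.exists_algEquiv_conj`).
* `KummerEigenvector.exists_map_eq_mul_pow` — the twisted relation `e(α) = x · α^m`.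
* `KummerEigenvector.apply_conj_eq_of_isOfFinOrder` — if the eigenvector is a ROOT OF UNITY `ω₁` with `ω₁^p ∈ K`
  (the capitulation case of the reflection map) then `χ(e⁻¹ τ e) = χ(τ)`: conjugation acts trivially on the
  character of `K(ω₁)/K`, because `e` acts on `⟨ω₁⟩ ⊇ μ_p` by one exponent (the step that replaces Lang's
  ramification hypothesis for a non-trivial even character; Washington Thm. 10.9: "`rank ε_i A ≤ rank ε_j A`"
  with no side condition when `i ≠ 0` is even).

## References

* S. Lang, *Cyclotomic Fields I and II*, GTM 121 (1990), Ch. 13 §2, Thm. 2.1 and its proof (pp. 198–200). [Lang1990]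
* L. C. Washington, *Introduction to Cyclotomic Fields*, 2nd ed., GTM 83 (1997), §10.2, Thm. 10.9 and its proof,
  Thm. 10.11 (Leopoldt's Spiegelungssatz). [Washington1997]
* J. Neukirch, *Algebraic Number Theory* (1999), Ch. I §3 Thm. (3.3), §8 Prop. (8.2). [NeukirchANT1999]
-/

noncomputable section

open NumberField NumberField.IsCMField IsDedekindDomain Module IntermediateField
open scoped nonZeroDivisors

namespace Literature.NumberTheory.NumberFields

section IdealLemmas

/-- `I ^ n = J ^ n` with `n ≠ 0` forces `I = J` for ideals of a Dedekind domain (private copy of the helper of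
`KummerPlusMinusRankRadical.lean`). [cite: NeukirchANT1999, Ch. I §3 Thm. (3.3)] -/
private theorem ideal_eq_of_pow_eq_pow_of_ne_zero'' {R : Type*} [CommRing R] [IsDedekindDomain R]
    {I J : Ideal R} {n : ℕ} (hn : n ≠ 0) (h : I ^ n = J ^ n) : I = J := by
  classical
  have hzero : ∀ {I J : Ideal R}, I ^ n = J ^ n → I = ⊥ → J = ⊥ := by
    intro I J h hI
    rw [hI, ← Ideal.zero_eq_bot, zero_pow hn] at h
    rw [← Ideal.zero_eq_bot]
    exact pow_eq_zero_iff hn |>.mp h.symm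
  by_cases hI : I = ⊥
  · rw [hI, hzero h hI]
  by_cases hJ : J = ⊥
  · exact absurd (hzero h.symm hJ) hI
  have hf := congrArg UniqueFactorizationMonoid.normalizedFactors h
  rw [UniqueFactorizationMonoid.normalizedFactors_pow,
    UniqueFactorizationMonoid.normalizedFactors_pow] at hf
  have hf' : UniqueFactorizationMonoid.normalizedFactors I =
      UniqueFactorizationMonoid.normalizedFactors J := by
    ext q
    have := congrArg (Multiset.count q) hf
    simp only [Multiset.count_nsmul] at this
    exact Nat.eq_of_mul_eq_mul_left (Nat.pos_of_ne_zero hn) this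
  rw [← Ideal.prod_normalizedFactors_eq_self hI, ← Ideal.prod_normalizedFactors_eq_self hJ, hf']

end IdealLemmas

section Radical

variable (K : Type) [Field K] [NumberField K] [IsCMField K]

/-- **The radical lemma with the minus part as a hypothesis.**  Let `K` be a CM number field, `p` an odd prime,
`M/K` finite Galois inside `K̄`, unramified at every finite prime of `K`, `g` a ring automorphism of `M`
restricting to complex conjugation on `K`, and `α ∈ 𝓞_M` an integral radical, `α^p = β ∈ 𝓞_K ∖ 0`, with
**`α · g(α) ∈ K`**.  Then there are `𝔟` and `c'` with `(β) = 𝔟^p`, `𝔟 𝔟̄ = (c')`, `c'^p = β β̄`,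
`N_{K/K⁺}[𝔟] = 1` and `[𝔟]^p = 1` — steps §C–§E of Lang's proof, verbatim as in
`KummerRank.exists_ideal_of_radical` (where `α · g(α) ∈ K` is derived from the lift structure `M = K E₁`).
[cite: Lang1990, Ch. 13 §2, Thm. 2.1 (proof: "there exists an ideal `𝔟` of `K` such that `(b) = 𝔟^p` …
`φ⁻ : V⁻ → C_p⁻`")] -/
theorem KummerRank.exists_ideal_of_radical_of_mul_mem_range {p : ℕ} (hp : p.Prime) (hp2 : p ≠ 2)
    {M : IntermediateField K (AlgebraicClosure K)} [FiniteDimensional K M] [NumberField M]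
    (hMunr : ∀ v : HeightOneSpectrum (𝓞 K), Algebra.IsUnramifiedIn (𝓞 M) v.asIdeal)
    (g : M ≃+* M)
    (hg : ∀ x : K, g (algebraMap K M x) = algebraMap K M (complexConj K x))
    {α : 𝓞 M} {β : 𝓞 K} (hβ0 : β ≠ 0) (hαβ : algebraMap (𝓞 K) (𝓞 M) β = α ^ p)
    (hmin : (α : M) * g (α : M) ∈ Set.range (algebraMap K M)) :
    ∃ (𝔟 : Ideal (𝓞 K)) (c' : 𝓞 K) (h𝔟mem : 𝔟 ∈ (Ideal (𝓞 K))⁰),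
      Ideal.span {β} = 𝔟 ^ p ∧ 𝔟 ≠ ⊥ ∧
      𝔟 * 𝔟.map (AmbiguousClass.intAut (complexConj K) : 𝓞 K →+* 𝓞 K) = Ideal.span {c'} ∧
      c' ^ p = β * AmbiguousClass.intAut (complexConj K) β ∧
      classGroupNorm (maximalRealSubfield K) K (ClassGroup.mk0 ⟨𝔟, h𝔟mem⟩) = 1 ∧
      ClassGroup.mk0 ⟨𝔟, h𝔟mem⟩ ^ p = 1 := by
  classical
  haveI : Fact p.Prime := ⟨hp⟩
  have h2 : finrank (maximalRealSubfield K) K = 2 :=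
    (IsCMField.isQuadraticExtension K).finrank_eq_two
  haveI : FiniteDimensional (maximalRealSubfield K) K := Module.finite_of_finrank_eq_succ h2
  have hαβM : algebraMap K M (β : K) = (α : M) ^ p := by
    have h1 := congrArg (fun z : 𝓞 M => (z : M)) hαβ
    simp only [RingOfIntegers.coe_eq_algebraMap, map_pow] at h1
    rw [← IsScalarTower.algebraMap_apply (𝓞 K) (𝓞 M) M β,
      IsScalarTower.algebraMap_apply (𝓞 K) K M β] at h1
    exact h1
  obtain ⟨c, hc⟩ := hmin
  -- `c` is integral
  have hαint : IsIntegral ℤ (α : M) := α.isIntegral_coe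
  have hcint : IsIntegral ℤ c := by
    apply (isIntegral_algebraMap_iff (FaithfulSMul.algebraMap_injective K M)).mp
    rw [hc]
    exact hαint.mul (map_isIntegral_int g hαint)
  obtain ⟨c', hc'⟩ : ∃ c' : 𝓞 K, (c' : K) = c := ⟨⟨c, hcint⟩, rfl⟩
  -- `c ^ p = β β̄`
  have hkeyK : (c : K) ^ p = (β : K) * complexConj K β := by
    apply FaithfulSMul.algebraMap_injective K M
    rw [map_pow, hc, mul_pow, ← hαβM, ← map_pow, ← hαβM, hg, ← map_mul]
  have hβK : (β : K) ≠ 0 := RingOfIntegers.coe_ne_zero_iff.mpr hβ0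
  have hc0 : c' ≠ 0 := by
    intro h0
    have hc0' : c = 0 := by rw [← hc', h0]; rfl
    rw [hc0', zero_pow hp.ne_zero, zero_eq_mul] at hkeyK
    rcases hkeyK with h | h
    · exact hβK h
    · exact hβK ((map_eq_zero _).mp h)
  have hkey : c' ^ p = β * AmbiguousClass.intAut (complexConj K) β := by
    apply RingOfIntegers.ext
    simp only [map_pow, map_mul]
    rw [show algebraMap (𝓞 K) K c' = c from hc']
    exact hkeyK
  /- `(β) = 𝔟^p`, `(β̄) = 𝔟̄^p`, `𝔟 𝔟̄ = (c)`. -/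
  obtain ⟨𝔟, h𝔟⟩ := exists_span_eq_pow_of_forall_count_dvd hβ0 (n := p)
    (fun v => dvd_count_of_eq_pow_of_isUnramifiedIn hβ0 hαβ v (hMunr v))
  have h𝔟σ : Ideal.span {AmbiguousClass.intAut (complexConj K) β} =
      (𝔟.map (AmbiguousClass.intAut (complexConj K) : 𝓞 K →+* 𝓞 K)) ^ p := by
    have := congrArg (Ideal.map (AmbiguousClass.intAut (complexConj K) : 𝓞 K →+* 𝓞 K)) h𝔟
    rwa [Ideal.map_span, Set.image_singleton, Ideal.map_pow] at this
  have hprod : (𝔟 * 𝔟.map (AmbiguousClass.intAut (complexConj K) : 𝓞 K →+* 𝓞 K)) ^ p =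
      Ideal.span {c'} ^ p := by
    rw [mul_pow, ← h𝔟, ← h𝔟σ, Ideal.span_singleton_mul_span_singleton, Ideal.span_singleton_pow,
      hkey]
  have h𝔟𝔟 : 𝔟 * 𝔟.map (AmbiguousClass.intAut (complexConj K) : 𝓞 K →+* 𝓞 K) =
      Ideal.span {c'} :=
    ideal_eq_of_pow_eq_pow_of_ne_zero'' hp.ne_zero hprod
  have h𝔟0 : 𝔟 ≠ ⊥ := by
    intro h0
    rw [h0, ← Ideal.zero_eq_bot, zero_pow hp.ne_zero, Ideal.zero_eq_bot,
      Ideal.span_singleton_eq_bot] at h𝔟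
    exact hβ0 h𝔟
  have h𝔟mem : 𝔟 ∈ (Ideal (𝓞 K))⁰ := mem_nonZeroDivisors_of_ne_zero (by simpa using h𝔟0)
  /- The class `x = [𝔟]`: `x^p = 1`, `i(N x) = [𝔟 𝔟̄] = 1`, hence `N x = 1`. -/
  have hxp : ClassGroup.mk0 ⟨𝔟, h𝔟mem⟩ ^ p = 1 := by
    have hmem : 𝔟 ^ p ∈ (Ideal (𝓞 K))⁰ := pow_mem h𝔟mem p
    rw [← map_pow, show (⟨𝔟, h𝔟mem⟩ ^ p : (Ideal (𝓞 K))⁰) = ⟨𝔟 ^ p, hmem⟩ from rfl]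
    exact (ClassGroup.mk0_eq_one_iff hmem).mpr ⟨⟨β, h𝔟.symm⟩⟩
  have hiN : classGroupExtend (maximalRealSubfield K) K
      (classGroupNorm (maximalRealSubfield K) K (ClassGroup.mk0 ⟨𝔟, h𝔟mem⟩)) = 1 := by
    have hmem : 𝔟 * 𝔟.map (AmbiguousClass.intAut (complexConj K) : 𝓞 K →+* 𝓞 K) ∈
        (Ideal (𝓞 K))⁰ := by
      rw [h𝔟𝔟]
      refine mem_nonZeroDivisors_of_ne_zero ?_
      rw [Ne, Submodule.zero_eq_bot, Ideal.span_singleton_eq_bot]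
      exact hc0
    rw [IsCMField.classGroupExtend_classGroupNorm, AmbiguousClass.mulEquiv_mk0, ← map_mul,
      show ((⟨𝔟, h𝔟mem⟩ : (Ideal (𝓞 K))⁰) * ⟨_, AmbiguousClass.map_mem_nonZeroDivisors
        (complexConj K) ⟨𝔟, h𝔟mem⟩⟩ : (Ideal (𝓞 K))⁰) = ⟨_, hmem⟩ from rfl]
    exact (ClassGroup.mk0_eq_one_iff hmem).mpr ⟨⟨_, h𝔟𝔟⟩⟩
  have hN2 := sq_eq_one_of_classGroupExtend_eq_one K hiN
  have hNp : classGroupNorm (maximalRealSubfield K) K (ClassGroup.mk0 ⟨𝔟, h𝔟mem⟩) ^ p = 1 := by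
    rw [← map_pow, hxp, map_one]
  have hN1 : classGroupNorm (maximalRealSubfield K) K (ClassGroup.mk0 ⟨𝔟, h𝔟mem⟩) = 1 := by
    have h := Nat.dvd_gcd (orderOf_dvd_of_pow_eq_one hN2) (orderOf_dvd_of_pow_eq_one hNp)
    rw [Nat.Coprime.gcd_eq_one ((Nat.coprime_primes Nat.prime_two hp).mpr hp2.symm),
      Nat.dvd_one] at h
    exact orderOf_eq_one_iff.mp h
  exact ⟨𝔟, c', h𝔟mem, h𝔟, h𝔟0, h𝔟𝔟, hkey, hN1, hxp⟩

end Radical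

namespace KummerEigenvector

section Conj

variable {F K M : Type*} [Field F] [Field K] [Field M] [Algebra F K] [Algebra K M]

/-- **The conjugate `e⁻¹ τ e ∈ Gal(M/K)` of `τ ∈ Gal(M/K)` by a ring automorphism `e` of `M` restricting to an
automorphism `σ` of `K`** (pointwise form: `(e⁻¹τe)(y) = e⁻¹(τ(e y))`; it is `K`-linear because `e` maps `K` to `K`).
(Washington, proof of Thm. 10.9: "`G` acts on `Gal(L/K)` by conjugation"; cf. the tree's
`hilbertClassField.exists_algEquiv_conj`.) [cite: Washington1997, §10.2, Thm. 10.9 (proof)] -/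
theorem exists_conj (e : M ≃+* M) (σ : K ≃ₐ[F] K)
    (he : ∀ k : K, e (algebraMap K M k) = algebraMap K M (σ k)) (τ : M ≃ₐ[K] M) :
    ∃ τ' : M ≃ₐ[K] M, ∀ y : M, τ' y = e.symm (τ (e y)) := by
  have he' : ∀ k : K, e.symm (algebraMap K M k) = algebraMap K M (σ.symm k) := by
    intro k
    apply e.injective
    rw [RingEquiv.apply_symm_apply, he, AlgEquiv.apply_symm_apply]
  refine ⟨AlgEquiv.ofRingEquiv (f := e.trans (τ.toRingEquiv.trans e.symm)) fun k => ?_, fun y => rfl⟩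
  change e.symm (τ (e (algebraMap K M k))) = algebraMap K M k
  rw [he, AlgEquiv.commutes, he', AlgEquiv.symm_apply_apply]

end Conj

section Transport

variable {F K M : Type*} [Field F] [Field K] [Field M] [Algebra F K] [Algebra K M]
  [FiniteDimensional K M] [IsGalois K M]

/-- **Transport of an eigenvector under an automorphism of the base (the twisted minus part).**  Let `M/K` be
finite Galois, `e` a ring automorphism of `M` restricting to the automorphism `σ` of `K`, `conj τ = e⁻¹ τ e` the
conjugation on `Gal(M/K)`, `χ : Gal(M/K) → K^×` a character and `m : ℕ` with `σ(χ(e⁻¹τe)) = χ(τ)^m` for all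
`τ`.  Then for every `χ`-eigenvector `α` (`τ α = χ(τ) α`): **`e(α) = x · α^m` with `x ∈ K`** — indeed
`τ(e α) = e((e⁻¹τe) α) = σ(χ(e⁻¹τe)) · e α = χ(τ)^m · e α`, so `e(α)/α^m` is fixed by `Gal(M/K)`.  For `e` a
lift of complex conjugation and `m ≡ −1` this is «`α · ḡα ∈ K`» (the tree's
`IsCMField.mul_conjLift_mem_range`). [cite: Washington1997, §10.2, Thm. 10.9 (proof)]
[cite: Lang1990, Ch. 13 §2, Thm. 2.1 (proof)] -/
theorem exists_map_eq_mul_pow (e : M ≃+* M) (σ : K ≃ₐ[F] K)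
    (he : ∀ k : K, e (algebraMap K M k) = algebraMap K M (σ k))
    (conj : (M ≃ₐ[K] M) → (M ≃ₐ[K] M)) (hconj : ∀ (τ : M ≃ₐ[K] M) (y : M), conj τ y = e.symm (τ (e y)))
    (χ : (M ≃ₐ[K] M) →* Kˣ) (m : ℕ)
    (hχ : ∀ τ : M ≃ₐ[K] M, σ ((χ (conj τ) : Kˣ) : K) = ((χ τ : Kˣ) : K) ^ m)
    {α : M} (hα : ∀ τ : M ≃ₐ[K] M, τ α = ((χ τ : Kˣ) : K) • α) :
    ∃ x : K, e α = algebraMap K M x * α ^ m := by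
  by_cases hα0 : α = 0
  · refine ⟨0, ?_⟩
    subst hα0
    rw [map_zero e, map_zero (algebraMap K M), zero_mul]
  -- `τ (e α) = χ(τ)^m • e α`
  have heα : ∀ τ : M ≃ₐ[K] M, τ (e α) = (((χ τ : Kˣ) : K) ^ m) • e α := by
    intro τ
    have h1 : τ (e α) = e (conj τ α) := by
      rw [hconj, RingEquiv.apply_symm_apply]
    rw [h1, hα (conj τ), Algebra.smul_def, map_mul, he, hχ, ← Algebra.smul_def]
  have hαm : ∀ τ : M ≃ₐ[K] M, τ (α ^ m) = (((χ τ : Kˣ) : K) ^ m) • α ^ m := by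
    intro τ
    rw [map_pow, hα τ, smul_pow]
  have hαm0 : α ^ m ≠ 0 := pow_ne_zero _ hα0
  obtain ⟨x, hx⟩ := (IsGalois.mem_range_algebraMap_iff_fixed (e α / α ^ m)).mpr fun τ => by
    rw [map_div₀, heα, hαm, Algebra.smul_def, Algebra.smul_def, mul_div_mul_left]
    exact (map_ne_zero _).mpr (pow_ne_zero _ (χ τ).ne_zero)
  exact ⟨x, by rw [hx, div_mul_cancel₀ _ hαm0]⟩

omit [FiniteDimensional K M] [IsGalois K M] in
/-- **Conjugation acts trivially on the character of a radical root of unity.**  Let `M/K` be finite Galois,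
`e` a ring automorphism of `M` restricting to `σ` on `K`, `conj τ = e⁻¹ τ e`, `ζ ∈ K` a primitive `p`-th root of
unity (`p` prime), `χ : Gal(M/K) → K^×` a character killed by `p`, and `ω₁ ∈ M` a `χ`-eigenvector which is a
ROOT OF UNITY with `ω₁^p ∈ K`.  Then **`χ(e⁻¹ τ e) = χ(τ)` for all `τ`**.  Proof: if `p ∤ ord ω₁` then `ω₁ ∈ K`
and `χ = 1`; otherwise `⟨ω₁⟩ ∋ ζ`, `e(ω₁) = ω₁^n` and `σ(ζ) = ζ^n` for ONE exponent `n`, so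
`(e⁻¹τe)(ω₁) = e⁻¹(χ(τ)^n ω₁^n) = χ(τ) ω₁` because `σ⁻¹(χ(τ)^n) = χ(τ)` (`χ(τ) ∈ μ_p = ⟨ζ⟩`).  This is the
step that frees the reflection map of a NON-TRIVIAL even character from any ramification hypothesis
(Washington Thm. 10.9: `rank ε_i A ≤ rank ε_j A` unconditionally; only `i = 0` involves `μ_p ⊂ B`).
[cite: Washington1997, §10.2, Thm. 10.9 (proof)] [cite: Lang1990, Ch. 13 §2, Thm. 2.1 (proof)] -/
theorem apply_conj_eq_of_isOfFinOrder {p : ℕ} (hp : p.Prime) {ζ : K} (hζ : IsPrimitiveRoot ζ p)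
    (e : M ≃+* M) (σ : K ≃ₐ[F] K)
    (he : ∀ k : K, e (algebraMap K M k) = algebraMap K M (σ k))
    (conj : (M ≃ₐ[K] M) → (M ≃ₐ[K] M)) (hconj : ∀ (τ : M ≃ₐ[K] M) (y : M), conj τ y = e.symm (τ (e y)))
    (χ : (M ≃ₐ[K] M) →* Kˣ) (hχp : ∀ τ : M ≃ₐ[K] M, χ τ ^ p = 1)
    {ω₁ : M} (hω₁ : IsOfFinOrder ω₁) (hω₁p : ω₁ ^ p ∈ Set.range (algebraMap K M))
    (hα : ∀ τ : M ≃ₐ[K] M, τ ω₁ = ((χ τ : Kˣ) : K) • ω₁) (τ : M ≃ₐ[K] M) :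
    χ (conj τ) = χ τ := by
  classical
  haveI : Fact p.Prime := ⟨hp⟩
  -- the order `N` of `ω₁`, a primitive `N`-th root of unity
  set N := orderOf ω₁ with hN
  have hNpos : 0 < N := hω₁.orderOf_pos
  have hprim : IsPrimitiveRoot ω₁ N := IsPrimitiveRoot.orderOf ω₁
  haveI : NeZero N := ⟨hNpos.ne'⟩
  have hω₁0 : ω₁ ≠ 0 := hprim.ne_zero hNpos.ne'
  -- case `p ∤ N`: `ω₁ ∈ K`, so `χ = 1`
  by_cases hpN : ¬ p ∣ N
  · have hmem : ω₁ ∈ Set.range (algebraMap K M) := by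
      obtain ⟨k, hk⟩ := hω₁p
      by_cases hN1 : N = 1
      · refine ⟨1, ?_⟩
        rw [map_one]
        exact (orderOf_eq_one_iff.mp (hN.symm.trans hN1 ▸ rfl : orderOf ω₁ = 1)).symm
      have hN1' : 1 < N := by omega
      have hcop : Nat.Coprime p N := (Nat.Prime.coprime_iff_not_dvd hp).mpr hpN
      obtain ⟨u, -, hu⟩ := Nat.exists_mul_mod_eq_one_of_coprime hcop hN1'
      refine ⟨k ^ u, ?_⟩
      rw [map_pow, hk, ← pow_mul, ← pow_mod_orderOf, ← hN, hu, pow_one]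
    have h1 : χ = 1 := eq_one_of_mem_range hα hω₁0 hmem
    rw [h1, MonoidHom.one_apply, MonoidHom.one_apply]
  replace hpN : p ∣ N := not_not.mp hpN
  -- `ζ_M := algebraMap ζ` is a `p`-th root of unity, hence a power of `ω₁`
  set ζM := algebraMap K M ζ with hζM
  have hζM' : IsPrimitiveRoot ζM p := hζ.map_of_injective (FaithfulSMul.algebraMap_injective K M)
  have hζMN : ζM ^ N = 1 := by
    obtain ⟨d, hd⟩ := hpN
    rw [hd, pow_mul, hζM'.pow_eq_one, one_pow]
  obtain ⟨j, -, hj⟩ := hprim.eq_pow_of_pow_eq_one hζMN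
  -- `e ω₁ = ω₁ ^ n`
  have heN : (e ω₁) ^ N = 1 := by rw [← map_pow, hprim.pow_eq_one, map_one]
  obtain ⟨n, -, hn⟩ := hprim.eq_pow_of_pow_eq_one heN
  -- `σ ζ = ζ ^ n`
  have hσζ : σ ζ = ζ ^ n := by
    apply FaithfulSMul.algebraMap_injective K M
    rw [← he, map_pow, ← hζM, ← hj, map_pow, ← hn, ← pow_mul, ← pow_mul, mul_comm]
  -- `χ τ` is a power of `ζ`
  have hχζ : ∀ ρ : M ≃ₐ[K] M, ∃ i : ℕ, ((χ ρ : Kˣ) : K) = ζ ^ i := by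
    intro ρ
    have h1 : ((χ ρ : Kˣ) : K) ^ p = 1 := by
      rw [← Units.val_pow_eq_pow_val, hχp, Units.val_one]
    obtain ⟨i, -, hi⟩ := hζ.eq_pow_of_pow_eq_one h1
    exact ⟨i, hi.symm⟩
  -- `σ⁻¹ (χ τ ^ n) = χ τ`
  have hσinv : ∀ ρ : M ≃ₐ[K] M, σ.symm (((χ ρ : Kˣ) : K) ^ n) = ((χ ρ : Kˣ) : K) := by
    intro ρ
    obtain ⟨i, hi⟩ := hχζ ρ
    apply σ.injective
    rw [AlgEquiv.apply_symm_apply, hi, map_pow, hσζ, ← pow_mul, ← pow_mul, mul_comm]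
  -- compute `(e⁻¹ τ e) ω₁`
  have he' : ∀ k : K, e.symm (algebraMap K M k) = algebraMap K M (σ.symm k) := by
    intro k
    apply e.injective
    rw [RingEquiv.apply_symm_apply, he, AlgEquiv.apply_symm_apply]
  have hcomp : conj τ ω₁ = ((χ τ : Kˣ) : K) • ω₁ := by
    rw [hconj, ← hn, map_pow, hα τ, smul_pow, Algebra.smul_def, map_mul, he', hσinv,
      Algebra.smul_def]
    congr 1
    apply e.injective
    rw [RingEquiv.apply_symm_apply, hn]
  have h2 := hα (conj τ)
  rw [hcomp] at h2
  have h3 : ((χ τ : Kˣ) : K) = ((χ (conj τ) : Kˣ) : K) := by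
    have h4 := congrArg (fun z => z * ω₁⁻¹) h2
    simp only [Algebra.smul_def, mul_assoc, mul_inv_cancel₀ hω₁0, mul_one] at h4
    exact (FaithfulSMul.algebraMap_injective K M) h4
  exact Units.ext h3.symm

end Transport

end KummerEigenvector

end Literature.NumberTheory.NumberFields

end
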